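import Mathlib
import Summits.NavierStokesRegularity.NavierStokesRegularity.Theorems.SubOnsagerCeilingKPLeakPocketStarvation
import HarnessLib

/-!
# STARVED NETWORKS WITH A SHARED LEAK POCKET — the starved live in-fluxes (part 2 of 3)
# (helper file for the crux `SubOnsagerCeiling.ForwardTailCeilingKP`, stmt-NavierStokesRegularity-27057, `--supports`)

Sequel of `Theorems/SubOnsagerCeilingKPLeakPocketStarvation.lean` (the LEAK-POCKET class: live modes `0,1,2` with any diagonal forward
network, leaking diagonally into the shared dead-end pocket `3`, no in-shell coupling; same-shell comparison `ρ·x_{e,N} ≤ x_{3,N}` for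
`ρ·w_{ae} ≤ W_a := α a a 3 (0,0,1)`).  With the second strength hypothesis `κ·(w_{a0} + w_{a1} + w_{a2}) ≤ W_a`:

* `leakPocket_out_le_liveIn` — live-block energy balance of a shell `n ≥ 1` (shell identity `kpProper_shellEnergy_identity` minus the
  pocket's in-flux): `∫ OUT_n ≤ ∫ IN_n − ∫ LEAKIN_n`;
* `leakPocket_leak_dominates` — pointwise, the leak in-flux of shell `n+1` is at least `ρκ ×` its live in-flux;
* `leakPocket_flux_step` — `(1 + ρκ)·(∫IN_{n+1} − ∫LEAKIN_{n+1}) ≤ ∫IN_n − ∫LEAKIN_n` (`n ≥ 1`);  `leakPocket_flux_le` — the live in-flux of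
  shell `m+1` is `≤ E₀·q^m`, `q = (1 + ρκ)⁻¹`.

The barrier (`ShellBarrierAt`, `D = (1+ρκ)²`, every ratio when `ρκ > ε₀`) is in `Theorems/SubOnsagerCeilingKPLeakPocketBarrier.lean`.
HONEST FRAMING: statements about Tao-type MODEL lattice ODEs (route SubOnsagerCeiling, rung TL-M2Break); one architecture class; no stub,
crux or summit is proved and nothing here bears on Navier–Stokes regularity. [cite: Tao2016AveragedNS, §4 (4.8)–(4.9), (4.13)]
-/

noncomputable section

-- the sub-problem namespace `NavierStokesRegularity.NavierStokesRegularity` is the tree's layout (D-0017)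
set_option linter.dupNamespace false

namespace Summit.NavierStokesRegularity.NavierStokesRegularity.Theorems

open Set Finset MeasureTheory intervalIntegral
open scoped Topology
open Literature.Analysis.FluidPDE.TaoCascade

section LeakPocketFlux

variable {α : Fin 4 → Fin 4 → Fin 4 → ℤ × ℤ × ℤ → ℝ}
  (hs : IsSymmetricCoeff α) (hc : IsCancellingCoeff α)
  (hO : ∀ (Y : Fin 4 → ℤ → ℝ → ℝ) (τ : ℝ), (∀ (j : Fin 4) (k : ℤ), 1 ≤ k → 0 ≤ Y j k τ) →
    ∀ δ : ℝ, 0 < δ → ∀ (i : Fin 4) (n : ℤ), 1 ≤ n → Y i n τ = 0 → 0 ≤ quadTerm δ α Y i n τ)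
  (hD : ∀ a b i : Fin 4, a ≠ b → α a b i (0, 0, 1) = 0)
  (h3w : ∀ e : Fin 4, α 3 3 e (0, 0, 1) = 0)
  (hIn : ∀ a b i : Fin 4, α a b i (0, 0, 0) = 0)
include hs hc hO hD h3w hIn

/-- **Live-block balance of a shell `n ≥ 1`**: `∫₀ᵗ OUT_n ≤ ∫₀ᵗ IN_n − ∫₀ᵗ LEAKIN_n` (`ν ≥ 0`; stored live energy and dissipation are `≥ 0`).
[cite: Tao2016AveragedNS, §4 (4.8)–(4.9), (4.13)] -/
theorem leakPocket_out_le_liveIn {ε₀ ν s : ℝ} (hε : 0 ≤ ε₀) (hν : 0 ≤ ν)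
    {X₀ : Fin 4 → ℝ} {X : Fin 4 → ℤ → ℝ → ℝ}
    (hdat : ∀ (i : Fin 4) (k : ℤ), X i k 0 = if k = 0 then X₀ i else 0)
    (hXc : ∀ (i : Fin 4) (k : ℤ), Continuous (X i k))
    (hode : ∀ (i : Fin 4) (k : ℤ), ∀ t ∈ Icc (0 : ℝ) s, HasDerivWithinAt (X i k)
      (quadTerm ε₀ α X i k t - ν * (1 + ε₀) ^ ((2 : ℝ) * k) * X i k t) (Icc (0 : ℝ) s) t)
    {n : ℤ} (hn : 1 ≤ n) :
    ∀ t ∈ Icc (0 : ℝ) s,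
      ∫ τ in (0 : ℝ)..t, (1 + ε₀) ^ ((5 : ℝ) * n / 2) * ∑ i, ∑ j, α i i j (0, 0, 1) * X i n τ ^ 2 * X j (n + 1) τ ≤
        (∫ τ in (0 : ℝ)..t, (1 + ε₀) ^ ((5 : ℝ) * ((n : ℝ) - 1) / 2) * ∑ i, ∑ a, α a a i (0, 0, 1) * X a (n - 1) τ ^ 2 * X i n τ) -
          ∫ τ in (0 : ℝ)..t, (1 + ε₀) ^ ((5 : ℝ) * ((n : ℝ) - 1) / 2) *
            (X 3 n τ * ∑ a, α a a 3 (0, 0, 1) * X a (n - 1) τ ^ 2) := by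
  have hb : (0 : ℝ) < 1 + ε₀ := by linarith
  set Λm : ℝ := (1 + ε₀) ^ ((5 : ℝ) * ((n : ℝ) - 1) / 2) with hΛm
  set Λn : ℝ := (1 + ε₀) ^ ((5 : ℝ) * n / 2) with hΛn
  set ν' : ℝ := ν * (1 + ε₀) ^ ((2 : ℝ) * n) with hν'
  have hν'0 : 0 ≤ ν' := by positivity
  set IN : ℝ → ℝ := fun τ => Λm * ∑ i, ∑ a, α a a i (0, 0, 1) * X a (n - 1) τ ^ 2 * X i n τ with hIN
  set LEAKIN : ℝ → ℝ := fun τ => Λm * (X 3 n τ * ∑ a, α a a 3 (0, 0, 1) * X a (n - 1) τ ^ 2) with hLEAKIN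
  set OUT : ℝ → ℝ := fun τ => Λn * ∑ i, ∑ j, α i i j (0, 0, 1) * X i n τ ^ 2 * X j (n + 1) τ with hOUT
  set DISS : ℝ → ℝ := fun τ => ν' * (X 0 n τ ^ 2 + X 1 n τ ^ 2 + X 2 n τ ^ 2) with hDISS
  have hINc : Continuous IN := continuous_const.mul (continuous_finsetSum _ fun i _ => continuous_finsetSum _ fun a _ =>
    (continuous_const.mul ((hXc a _).pow 2)).mul (hXc i _))
  have hLEAKINc : Continuous LEAKIN := continuous_const.mul ((hXc 3 _).mul (continuous_finsetSum _ fun a _ =>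
    continuous_const.mul ((hXc a _).pow 2)))
  have hOUTc : Continuous OUT := continuous_const.mul (continuous_finsetSum _ fun i _ => continuous_finsetSum _ fun j _ =>
    (continuous_const.mul ((hXc i _).pow 2)).mul (hXc j _))
  have hDISSc : Continuous DISS := continuous_const.mul ((((hXc 0 _).pow 2).add ((hXc 1 _).pow 2)).add ((hXc 2 _).pow 2))
  set L : ℝ → ℝ := fun τ => (1 / 2 : ℝ) * X 0 n τ ^ 2 + (1 / 2 : ℝ) * X 1 n τ ^ 2 + (1 / 2 : ℝ) * X 2 n τ ^ 2 with hL
  set G : ℝ → ℝ := fun τ => L τ - (∫ u in (0 : ℝ)..τ, IN u) + (∫ u in (0 : ℝ)..τ, LEAKIN u) + (∫ u in (0 : ℝ)..τ, OUT u) +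
    ∫ u in (0 : ℝ)..τ, DISS u with hG
  have hprim : ∀ {f : ℝ → ℝ}, Continuous f → ∀ τ : ℝ,
      HasDerivWithinAt (fun u => ∫ v in (0 : ℝ)..u, f v) (f τ) (Icc 0 s) τ := by
    intro f hf τ
    exact (intervalIntegral.integral_hasDerivAt_right (hf.intervalIntegrable _ _)
      (hf.stronglyMeasurableAtFilter _ _) hf.continuousAt).hasDerivWithinAt
  have hGd : ∀ τ ∈ Icc (0 : ℝ) s, HasDerivWithinAt G 0 (Icc 0 s) τ := by
    intro τ hτ
    have hsq : ∀ i : Fin 4, HasDerivWithinAt (fun u => (1 / 2 : ℝ) * X i n u ^ 2)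
        ((1 / 2 : ℝ) * (((2 : ℕ) : ℝ) * X i n τ ^ (2 - 1) *
          (quadTerm ε₀ α X i n τ - ν * (1 + ε₀) ^ ((2 : ℝ) * n) * X i n τ))) (Icc 0 s) τ :=
      fun i => ((hode i n τ hτ).pow 2).const_mul (1 / 2)
    have hLd : HasDerivWithinAt L
        ((1 / 2 : ℝ) * (((2 : ℕ) : ℝ) * X 0 n τ ^ (2 - 1) * (quadTerm ε₀ α X 0 n τ - ν * (1 + ε₀) ^ ((2 : ℝ) * n) * X 0 n τ)) +
          (1 / 2 : ℝ) * (((2 : ℕ) : ℝ) * X 1 n τ ^ (2 - 1) * (quadTerm ε₀ α X 1 n τ - ν * (1 + ε₀) ^ ((2 : ℝ) * n) * X 1 n τ)) +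
          (1 / 2 : ℝ) * (((2 : ℕ) : ℝ) * X 2 n τ ^ (2 - 1) * (quadTerm ε₀ α X 2 n τ - ν * (1 + ε₀) ^ ((2 : ℝ) * n) * X 2 n τ)))
        (Icc 0 s) τ := ((hsq 0).add (hsq 1)).add (hsq 2)
    have h := ((((hLd.sub (hprim hINc τ)).add (hprim hLEAKINc τ)).add (hprim hOUTc τ)).add (hprim hDISSc τ))
    refine h.congr_deriv ?_
    have hshell := kpProper_shellEnergy_identity hs hc hO hD ε₀ X n τ
    rw [Fin.sum_univ_four] at hshell
    have hpocket : X 3 n τ * quadTerm ε₀ α X 3 n τ = LEAKIN τ := by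
      rw [leakPocket_quadTerm_pocket hs hc hO hD h3w hIn]
      simp only [hLEAKIN]
      ring
    simp only [hIN, hOUT, hDISS] at hshell ⊢
    push_cast
    have e3 : quadTerm ε₀ α X 0 n τ * X 0 n τ + quadTerm ε₀ α X 1 n τ * X 1 n τ + quadTerm ε₀ α X 2 n τ * X 2 n τ =
        (Λm * ∑ i, ∑ a, α a a i (0, 0, 1) * X a (n - 1) τ ^ 2 * X i n τ -
          Λn * ∑ i, ∑ j, α i i j (0, 0, 1) * X i n τ ^ 2 * X j (n + 1) τ) - LEAKIN τ := by
      rw [← hpocket]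
      simp only [hΛm, hΛn]
      linarith [hshell]
    linear_combination e3
  have hGc : ContinuousOn G (Icc 0 s) := fun τ hτ => (hGd τ hτ).continuousWithinAt
  have hGd' : ∀ u ∈ Ico (0 : ℝ) s, HasDerivWithinAt G 0 (Ici u) u := fun u hu =>
    (hGd u (Ico_subset_Icc_self hu)).mono_of_mem_nhdsWithin
      (Filter.mem_of_superset (Icc_mem_nhdsGE hu.2) (Icc_subset_Icc hu.1 le_rfl))
  have hG0 : G 0 = 0 := by
    have h0 : ∀ i : Fin 4, X i n 0 = 0 := fun i => by rw [hdat]; simp; omega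
    simp [hG, hL, h0]
  intro t ht
  have hGt : G t = 0 := by
    have h := constant_of_has_deriv_right_zero hGc hGd' t ht
    rw [hG0] at h
    exact h
  have hV : 0 ≤ ∫ u in (0 : ℝ)..t, DISS u :=
    intervalIntegral.integral_nonneg ht.1 fun u _ => mul_nonneg hν'0 (by positivity)
  have hE : 0 ≤ L t := by positivity
  have key : (∫ u in (0 : ℝ)..t, OUT u) ≤ (∫ u in (0 : ℝ)..t, IN u) - ∫ u in (0 : ℝ)..t, LEAKIN u := by
    simp only [hG] at hGt
    linarith
  simpa only [hOUT, hIN, hLEAKIN] using key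

omit hs hc hD h3w hIn in
/-- **The leak dominates the live in-flux, pointwise**: at a shell `N ≥ 1`, with `ρ x_{e,N} ≤ x_{3,N}` for the live `e` (hypothesis `hcmp`),
`ρ·w_{ae} ≥ 0`-weights and `κ(w_{a0}+w_{a1}+w_{a2}) ≤ W_a`:
`ρκ·(Σ_{i,a} w_{ai} y_a² x_{i,N} − x_{3,N} Σ_a W_a y_a²) ≤ x_{3,N} Σ_a W_a y_a²` for every `y` (the squares of shell `N-1`).
[cite: Tao2016AveragedNS, §4 (4.13)] -/
theorem leakPocket_leak_dominates {ρ κ : ℝ} (hκ0 : 0 ≤ κ)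
    (hκ : ∀ a : Fin 4, κ * (α a a 0 (0, 0, 1) + α a a 1 (0, 0, 1) + α a a 2 (0, 0, 1)) ≤ α a a 3 (0, 0, 1))
    (y x : Fin 4 → ℝ) (hx3 : 0 ≤ x 3) (hcmp : ∀ e : Fin 4, e ≠ 3 → ρ * x e ≤ x 3) :
    ρ * κ * (∑ i, ∑ a, α a a i (0, 0, 1) * y a ^ 2 * x i - x 3 * ∑ a, α a a 3 (0, 0, 1) * y a ^ 2) ≤
      x 3 * ∑ a, α a a 3 (0, 0, 1) * y a ^ 2 := by
  have hw0 : ∀ a i : Fin 4, 0 ≤ α a a i (0, 0, 1) := fun a i => kpProper_feed_nonneg hO a i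
  have h0 := hcmp 0 (by decide)
  have h1 := hcmp 1 (by decide)
  have h2 := hcmp 2 (by decide)
  have hper : ∀ a : Fin 4, ρ * κ * (y a ^ 2 * (α a a 0 (0, 0, 1) * x 0 + α a a 1 (0, 0, 1) * x 1 + α a a 2 (0, 0, 1) * x 2)) ≤
      y a ^ 2 * (α a a 3 (0, 0, 1) * x 3) := by
    intro a
    have hsq : 0 ≤ y a ^ 2 := sq_nonneg _
    have g0 := mul_le_mul_of_nonneg_left h0 (hw0 a 0)
    have g1 := mul_le_mul_of_nonneg_left h1 (hw0 a 1)
    have g2 := mul_le_mul_of_nonneg_left h2 (hw0 a 2)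
    have hlin : ρ * (α a a 0 (0, 0, 1) * x 0 + α a a 1 (0, 0, 1) * x 1 + α a a 2 (0, 0, 1) * x 2) ≤
        (α a a 0 (0, 0, 1) + α a a 1 (0, 0, 1) + α a a 2 (0, 0, 1)) * x 3 := by linarith
    have hk := mul_le_mul_of_nonneg_right (hκ a) hx3
    have hl2 := mul_le_mul_of_nonneg_left hlin hκ0
    have hfin : ρ * κ * (α a a 0 (0, 0, 1) * x 0 + α a a 1 (0, 0, 1) * x 1 + α a a 2 (0, 0, 1) * x 2) ≤
        α a a 3 (0, 0, 1) * x 3 := by linarith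
    have := mul_le_mul_of_nonneg_left hfin hsq
    linarith
  have hdiff : ∑ i, ∑ a, α a a i (0, 0, 1) * y a ^ 2 * x i - x 3 * ∑ a, α a a 3 (0, 0, 1) * y a ^ 2 =
      ∑ a, y a ^ 2 * (α a a 0 (0, 0, 1) * x 0 + α a a 1 (0, 0, 1) * x 1 + α a a 2 (0, 0, 1) * x 2) := by
    rw [Finset.sum_comm]
    simp only [Fin.sum_univ_four]
    ring
  have hleak : x 3 * ∑ a, α a a 3 (0, 0, 1) * y a ^ 2 = ∑ a, y a ^ 2 * (α a a 3 (0, 0, 1) * x 3) := by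
    rw [Finset.mul_sum]
    refine Finset.sum_congr rfl fun a _ => ?_
    ring
  rw [hdiff, hleak, Finset.mul_sum]
  exact Finset.sum_le_sum fun a _ => hper a

/-- **Starvation of the live in-fluxes, one step** (`n ≥ 1`): `(1 + ρκ)·(∫IN_{n+1} − ∫LEAKIN_{n+1}) ≤ ∫IN_n − ∫LEAKIN_n`.
[cite: Tao2016AveragedNS, §4 (4.8)–(4.9), (4.13)] -/
theorem leakPocket_flux_step {ε₀ ν s ρ κ : ℝ} (hε : 0 ≤ ε₀) (hν : 0 ≤ ν) (hρ0 : 0 ≤ ρ) (hκ0 : 0 ≤ κ)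
    (hρ : ∀ a e : Fin 4, e ≠ 3 → ρ * α a a e (0, 0, 1) ≤ α a a 3 (0, 0, 1))
    (hκ : ∀ a : Fin 4, κ * (α a a 0 (0, 0, 1) + α a a 1 (0, 0, 1) + α a a 2 (0, 0, 1)) ≤ α a a 3 (0, 0, 1))
    {X₀ : Fin 4 → ℝ} {X : Fin 4 → ℤ → ℝ → ℝ}
    (hdat : ∀ (i : Fin 4) (k : ℤ), X i k 0 = if k = 0 then X₀ i else 0)
    (hXc : ∀ (i : Fin 4) (k : ℤ), Continuous (X i k))
    (hode : ∀ (i : Fin 4) (k : ℤ), ∀ t ∈ Icc (0 : ℝ) s, HasDerivWithinAt (X i k)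
      (quadTerm ε₀ α X i k t - ν * (1 + ε₀) ^ ((2 : ℝ) * k) * X i k t) (Icc (0 : ℝ) s) t)
    (hnn : ∀ t ∈ Icc (0 : ℝ) s, ∀ (i : Fin 4) (k : ℤ), 1 ≤ k → 0 ≤ X i k t) {n : ℤ} (hn : 1 ≤ n) :
    ∀ t ∈ Icc (0 : ℝ) s,
      (1 + ρ * κ) *
          ((∫ τ in (0 : ℝ)..t, (1 + ε₀) ^ ((5 : ℝ) * (((n + 1 : ℤ) : ℝ) - 1) / 2) *
              ∑ i, ∑ a, α a a i (0, 0, 1) * X a (n + 1 - 1) τ ^ 2 * X i (n + 1) τ) -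
            ∫ τ in (0 : ℝ)..t, (1 + ε₀) ^ ((5 : ℝ) * (((n + 1 : ℤ) : ℝ) - 1) / 2) *
              (X 3 (n + 1) τ * ∑ a, α a a 3 (0, 0, 1) * X a (n + 1 - 1) τ ^ 2)) ≤
        (∫ τ in (0 : ℝ)..t, (1 + ε₀) ^ ((5 : ℝ) * ((n : ℝ) - 1) / 2) * ∑ i, ∑ a, α a a i (0, 0, 1) * X a (n - 1) τ ^ 2 * X i n τ) -
          ∫ τ in (0 : ℝ)..t, (1 + ε₀) ^ ((5 : ℝ) * ((n : ℝ) - 1) / 2) *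
            (X 3 n τ * ∑ a, α a a 3 (0, 0, 1) * X a (n - 1) τ ^ 2) := by
  intro t ht
  have hb : (0 : ℝ) < 1 + ε₀ := by linarith
  have hA := leakPocket_out_le_liveIn hs hc hO hD h3w hIn hε hν hdat hXc hode hn t ht
  set Λn' : ℝ := (1 + ε₀) ^ ((5 : ℝ) * (((n + 1 : ℤ) : ℝ) - 1) / 2) with hΛn'
  have hΛn'0 : 0 ≤ Λn' := by positivity
  have hidx : (n + 1 - 1 : ℤ) = n := by omega
  set IN' : ℝ → ℝ := fun τ => Λn' * ∑ i, ∑ a, α a a i (0, 0, 1) * X a (n + 1 - 1) τ ^ 2 * X i (n + 1) τ with hIN'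
  set LEAKIN' : ℝ → ℝ := fun τ => Λn' * (X 3 (n + 1) τ * ∑ a, α a a 3 (0, 0, 1) * X a (n + 1 - 1) τ ^ 2) with hLEAKIN'
  have hIN'c : Continuous IN' := continuous_const.mul (continuous_finsetSum _ fun i _ => continuous_finsetSum _ fun a _ =>
    (continuous_const.mul ((hXc a _).pow 2)).mul (hXc i _))
  have hLEAKIN'c : Continuous LEAKIN' := continuous_const.mul ((hXc 3 _).mul (continuous_finsetSum _ fun a _ =>
    continuous_const.mul ((hXc a _).pow 2)))
  -- `OUT_n = IN_{n+1}`
  have hB : (∫ τ in (0 : ℝ)..t, (1 + ε₀) ^ ((5 : ℝ) * n / 2) * ∑ i, ∑ j, α i i j (0, 0, 1) * X i n τ ^ 2 * X j (n + 1) τ) =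
      ∫ τ in (0 : ℝ)..t, IN' τ :=
    intervalIntegral.integral_congr fun τ _ => kpProper_outFlux_eq_inFlux_succ (α := α) ε₀ X n τ
  -- the leak dominates `ρκ ×` the live in-flux of shell `n+1`
  have hC : ρ * κ * ((∫ τ in (0 : ℝ)..t, IN' τ) - ∫ τ in (0 : ℝ)..t, LEAKIN' τ) ≤ ∫ τ in (0 : ℝ)..t, LEAKIN' τ := by
    rw [← intervalIntegral.integral_sub (hIN'c.intervalIntegrable _ _) (hLEAKIN'c.intervalIntegrable _ _),
      ← intervalIntegral.integral_const_mul]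
    refine intervalIntegral.integral_mono_on ht.1 (((hIN'c.sub hLEAKIN'c).const_mul _).intervalIntegrable _ _)
      (hLEAKIN'c.intervalIntegrable _ _) fun τ hτ => ?_
    have hτs : τ ∈ Icc (0 : ℝ) s := ⟨hτ.1, hτ.2.trans ht.2⟩
    have hx3 : 0 ≤ X 3 (n + 1) τ := hnn τ hτs 3 _ (by omega)
    have hcmp : ∀ e : Fin 4, e ≠ 3 → ρ * X e (n + 1) τ ≤ X 3 (n + 1) τ := fun e he =>
      leakPocket_pocket_ge hs hc hO hD h3w hIn hε hρ0 hρ hdat hode hnn he (N := n + 1) (by omega) τ hτs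
    have h := leakPocket_leak_dominates hO hκ0 hκ (fun a => X a (n + 1 - 1) τ) (fun i => X i (n + 1) τ) hx3 hcmp
    simp only [hIN', hLEAKIN']
    have h' := mul_le_mul_of_nonneg_left h hΛn'0
    have e1 : ρ * κ * (Λn' * ∑ i, ∑ a, α a a i (0, 0, 1) * X a (n + 1 - 1) τ ^ 2 * X i (n + 1) τ -
        Λn' * (X 3 (n + 1) τ * ∑ a, α a a 3 (0, 0, 1) * X a (n + 1 - 1) τ ^ 2)) =
        Λn' * (ρ * κ * (∑ i, ∑ a, α a a i (0, 0, 1) * X a (n + 1 - 1) τ ^ 2 * X i (n + 1) τ -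
          X 3 (n + 1) τ * ∑ a, α a a 3 (0, 0, 1) * X a (n + 1 - 1) τ ^ 2)) := by ring
    rw [e1]
    exact h'
  have key : (1 + ρ * κ) * ((∫ τ in (0 : ℝ)..t, IN' τ) - ∫ τ in (0 : ℝ)..t, LEAKIN' τ) ≤
      (∫ τ in (0 : ℝ)..t, (1 + ε₀) ^ ((5 : ℝ) * ((n : ℝ) - 1) / 2) * ∑ i, ∑ a, α a a i (0, 0, 1) * X a (n - 1) τ ^ 2 * X i n τ) -
        ∫ τ in (0 : ℝ)..t, (1 + ε₀) ^ ((5 : ℝ) * ((n : ℝ) - 1) / 2) *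
          (X 3 n τ * ∑ a, α a a 3 (0, 0, 1) * X a (n - 1) τ ^ 2) := by
    rw [hB] at hA
    nlinarith [hA, hC]
  simpa only [hIN', hLEAKIN'] using key

/-- **Starvation of the live in-fluxes**: `∫IN_{m+1} − ∫LEAKIN_{m+1} ≤ E₀·q^m`, `q = (1 + ρκ)⁻¹`, for every `m : ℕ` (induction; base:
`∫IN_1 = ∫OUT_0 ≤ E₀` by the class-wide flux budget and `∫LEAKIN_1 ≥ 0`). [cite: Tao2016AveragedNS, §4 (4.8)–(4.9), (4.13)] -/
theorem leakPocket_flux_le {ε₀ ν s ρ κ : ℝ} (hε : 0 ≤ ε₀) (hν : 0 ≤ ν) (hρ0 : 0 ≤ ρ) (hκ0 : 0 ≤ κ)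
    (hρ : ∀ a e : Fin 4, e ≠ 3 → ρ * α a a e (0, 0, 1) ≤ α a a 3 (0, 0, 1))
    (hκ : ∀ a : Fin 4, κ * (α a a 0 (0, 0, 1) + α a a 1 (0, 0, 1) + α a a 2 (0, 0, 1)) ≤ α a a 3 (0, 0, 1))
    {X₀ : Fin 4 → ℝ} {X : Fin 4 → ℤ → ℝ → ℝ}
    (hdat : ∀ (i : Fin 4) (k : ℤ), X i k 0 = if k = 0 then X₀ i else 0)
    (hvan : ∀ (i : Fin 4) (k : ℤ), k < 0 → ∀ t : ℝ, X i k t = 0)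
    (hXc : ∀ (i : Fin 4) (k : ℤ), Continuous (X i k))
    (hode : ∀ (i : Fin 4) (k : ℤ), ∀ t ∈ Icc (0 : ℝ) s, HasDerivWithinAt (X i k)
      (quadTerm ε₀ α X i k t - ν * (1 + ε₀) ^ ((2 : ℝ) * k) * X i k t) (Icc (0 : ℝ) s) t)
    (hnn : ∀ t ∈ Icc (0 : ℝ) s, ∀ (i : Fin 4) (k : ℤ), 1 ≤ k → 0 ≤ X i k t) :
    ∀ m : ℕ, ∀ t ∈ Icc (0 : ℝ) s,
      (∫ τ in (0 : ℝ)..t, (1 + ε₀) ^ ((5 : ℝ) * ((((m : ℤ) + 1 : ℤ) : ℝ) - 1) / 2) *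
          ∑ i, ∑ a, α a a i (0, 0, 1) * X a ((m : ℤ) + 1 - 1) τ ^ 2 * X i ((m : ℤ) + 1) τ) -
        (∫ τ in (0 : ℝ)..t, (1 + ε₀) ^ ((5 : ℝ) * ((((m : ℤ) + 1 : ℤ) : ℝ) - 1) / 2) *
          (X 3 ((m : ℤ) + 1) τ * ∑ a, α a a 3 (0, 0, 1) * X a ((m : ℤ) + 1 - 1) τ ^ 2)) ≤
        (∑ i, (1 / 2 : ℝ) * X₀ i ^ 2) * ((1 + ρ * κ)⁻¹) ^ m := by
  have hr : 0 < 1 + ρ * κ := by positivity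
  have hb : (0 : ℝ) < 1 + ε₀ := by linarith
  have hw0 : ∀ a i : Fin 4, 0 ≤ α a a i (0, 0, 1) := fun a i => kpProper_feed_nonneg hO a i
  intro m
  induction m with
  | zero =>
    intro t ht
    have h := kpProper_bondFlux_budget hs hc hO hD hb hν hdat hvan hXc hode 0 t ht
    have hin : (∫ τ in (0 : ℝ)..t, (1 + ε₀) ^ ((5 : ℝ) * (((((0 : ℕ) : ℤ) + 1 : ℤ) : ℝ) - 1) / 2) *
          ∑ i, ∑ a, α a a i (0, 0, 1) * X a (((0 : ℕ) : ℤ) + 1 - 1) τ ^ 2 * X i (((0 : ℕ) : ℤ) + 1) τ) =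
        ∫ τ in (0 : ℝ)..t, (1 + ε₀) ^ ((5 : ℝ) * ((0 : ℕ) : ℝ) / 2) *
          ∑ i, ∑ j, α i i j (0, 0, 1) * X i ((0 : ℕ) : ℤ) τ ^ 2 * X j (((0 : ℕ) : ℤ) + 1) τ := by
      refine intervalIntegral.integral_congr fun τ _ => ?_
      have h' := (kpProper_outFlux_eq_inFlux_succ (α := α) ε₀ X ((0 : ℕ) : ℤ) τ).symm
      have hc' : ((5 : ℝ) * ((((0 : ℕ) : ℤ) : ℤ) : ℝ) / 2) = (5 : ℝ) * ((0 : ℕ) : ℝ) / 2 := by push_cast; ring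
      simpa [hc'] using h'
    have hleak0 : 0 ≤ ∫ τ in (0 : ℝ)..t, (1 + ε₀) ^ ((5 : ℝ) * (((((0 : ℕ) : ℤ) + 1 : ℤ) : ℝ) - 1) / 2) *
        (X 3 (((0 : ℕ) : ℤ) + 1) τ * ∑ a, α a a 3 (0, 0, 1) * X a (((0 : ℕ) : ℤ) + 1 - 1) τ ^ 2) := by
      refine intervalIntegral.integral_nonneg ht.1 fun τ hτ => ?_
      have hτs : τ ∈ Icc (0 : ℝ) s := ⟨hτ.1, hτ.2.trans ht.2⟩
      have hx3 : 0 ≤ X 3 (((0 : ℕ) : ℤ) + 1) τ := hnn τ hτs 3 _ (by simp)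
      exact mul_nonneg (by positivity) (mul_nonneg hx3 (Finset.sum_nonneg fun a _ => mul_nonneg (hw0 a 3) (sq_nonneg _)))
    rw [hin, pow_zero, mul_one]
    linarith
  | succ m ih =>
    intro t ht
    have hstep := leakPocket_flux_step hs hc hO hD h3w hIn hε hν hρ0 hκ0 hρ hκ hdat hXc hode hnn (n := (m : ℤ) + 1)
      (by omega) t ht
    have hih := ih t ht
    have hcast2 : (((m + 1 : ℕ) : ℤ)) = (m : ℤ) + 1 := by push_cast; ring
    rw [hcast2, pow_succ]
    have h2pre := le_trans (le_of_eq (mul_comm _ _)) hstep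
    have h2 := (le_mul_inv_iff₀ hr).2 h2pre
    calc _ ≤ _ := h2
      _ ≤ (∑ i, (1 / 2 : ℝ) * X₀ i ^ 2) * ((1 + ρ * κ)⁻¹) ^ m * (1 + ρ * κ)⁻¹ :=
          mul_le_mul_of_nonneg_right hih (inv_nonneg.2 hr.le)
      _ = _ := by ring

end LeakPocketFlux

end Summit.NavierStokesRegularity.NavierStokesRegularity.Theorems

end
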